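import Literature.NumberTheory.EllipticCurves.ZpExtensionEisensteinSelmerStructure
import HarnessLib

/-!
# Saturated level conditions of a tower are cartesian (the abstract core of Howard's H.3 for `F_𝔮`)

`Proofs` file (theorems only, plus one auxiliary iterated-reduction map; no named fact, no `sorry`), in
the currency of the tree's abstract towers `Literature.NumberTheory.EllipticCurves.Tower.*`
(`compatibleFamilies`, `saturatedFamilies`, `levelCondition`; file `ZpExtensionEisensteinSelmerStructure.lean`).

Howard 2004, Hypothesis H.3: «for every `v ∈ Σ(F)` the local condition `F` at `v` is cartesian on the category
`Quot(T)`» (Def. 1.1.2–1.1.3: for an injective morphism `α : T/IT → T/JT` the condition on `T/IT` is the one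
propagated back from `T/JT`); for the specialised Selmer structure `F_𝔮` it «follows from Lemma 3.7.1 of
[Mazur–Rubin] and the fact that `F_𝔮` on `T_𝔮` is obtained by propagation from `V_𝔮`» (arXiv:1202.6340
p. 16, L1–3) — i.e. from SATURATION. In the tree the level conditions of `F_𝔮` are
`Tower.levelCondition red p C k` = the `k`-th components of the `p`-SATURATED compatible families. This file
proves the cartesian property for them along the injective `Quot`-morphisms «multiplication by `p^d`»
ABSTRACTLY, from four inputs on the tower which the instantiator supplies cohomologically
(D1's memo `HOME/p1/H3-CARTESIAN-PLAN`, steps (L)/(E)):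

* (M) `mul (red^{(d)} y) = p^d • y` — the composite `T/p^{i+d} ↠ T/p^i ↪ T/p^{i+d}` is `×p^d`;
* (T) `p^i • H_i = 0` — `H¹(K_v, T/p^i T)` is killed by `p^i`;
* (L) LIFTABILITY: if `mul y` is the `(i+d)`-component of a compatible family then `y` is the `i`-component
  of a compatible family (long exact sequences + König, memo (L));
* (E) EXACTNESS at the limit: a compatible family vanishing at level `i + d` is `p^{i+d}`-divisible by a
  compatible family (`ker(H¹(T) → H¹(T/p^j)) = p^j H¹(T)`, memo (E)).

Main result `Tower.comap_levelCondition_eq_of_liftable` :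
`(levelCondition red p C (i+d)).comap mul = levelCondition red p C i`.

Cell `pub/bsd-print-x9`, shared μ-item of rows 9/10, skeleton v9 STUB 1b; seat `bsd-line-x10b-p2` LEAD g5.
No summit statement is proved; BSD is not proved by any of this.

References: B. Howard, Compositio Math. 140 (2004), Def. 1.1.2–1.1.3, H.3, Prop. 2.1.3 proof (arXiv:1202.6340
p. 5 L88–99, p. 7 L65–67, p. 16 L1–3); B. Mazur, K. Rubin, *Kolyvagin systems* (2004), Lemma 3.7.1.
-/

noncomputable section

universe u

namespace Literature.NumberTheory.EllipticCurves

namespace Tower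

variable {H : ℕ → Type u} [∀ j, AddCommGroup (H j)] (red : ∀ j, H (j + 1) →+ H j)

/-- The iterated reduction `red^{(d)} : H_{i+d} → H_i` of the tower.
[cite: Howard2004HeegnerKolyvagin, Def. 1.1.3 (arXiv Def. 2.1.3, p. 5: the morphisms of Quot(T))] -/
def redIter (i : ℕ) : (d : ℕ) → (H (i + d) →+ H i)
  | 0 => AddMonoidHom.id (H i)
  | d + 1 => (redIter i d).comp (red (i + d))

/-- `red^{(0)} = id`. [cite: Howard2004HeegnerKolyvagin, Def. 1.1.3 (arXiv p. 5)] -/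
@[simp]
theorem redIter_zero (i : ℕ) (y : H i) : redIter red i 0 y = y := rfl

/-- `red^{(d+1)} = red^{(d)} ∘ red`. [cite: Howard2004HeegnerKolyvagin, Def. 1.1.3 (arXiv p. 5)] -/
theorem redIter_succ (i d : ℕ) (y : H (i + d + 1)) :
    redIter red i (d + 1) y = redIter red i d (red (i + d) y) := rfl

/-- On a compatible family the iterated reduction of the `(i+d)`-component is the `i`-component.
[cite: SerreGaloisCohomology1997, Ch. I §2.2 (inverse limits)] -/
theorem redIter_apply_of_mem_compatibleFamilies {x : Π j, H j} (hx : x ∈ compatibleFamilies red)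
    (i d : ℕ) : redIter red i d (x (i + d)) = x i := by
  induction d with
  | zero => rfl
  | succ d ih =>
    rw [redIter_succ]
    have h := (mem_compatibleFamilies_iff red x).mp hx (i + d)
    rw [show x (i + (d + 1)) = x (i + d + 1) from rfl, h, ih]

/-- A natural multiple of a compatible family is compatible. [cite: SerreGaloisCohomology1997, Ch. I §2.2] -/
theorem nsmul_mem_compatibleFamilies {x : Π j, H j} (hx : x ∈ compatibleFamilies red) (n : ℕ) :
    n • x ∈ compatibleFamilies red :=
  AddSubgroup.nsmul_mem _ hx n

/-- A natural multiple of a saturated family is saturated (same exponent).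
[cite: Howard2004HeegnerKolyvagin, Def. 1.1.1 (arXiv Def. 2.1.1, propagation)] -/
theorem nsmul_mem_saturatedFamilies (p : ℕ) (C : ∀ j, AddSubgroup (H j)) {x : Π j, H j}
    (hx : x ∈ saturatedFamilies red p C) (n : ℕ) : n • x ∈ saturatedFamilies red p C :=
  AddSubgroup.nsmul_mem _ hx n

/-- **The easy inclusion of the cartesian property**: the level-`i` condition maps into the level-`(i+d)`
condition under any `mul : H_i → H_{i+d}` with `mul ∘ red^{(d)} = p^d` (the `Quot`-morphism `×p^d`):
`mul (x_i) = p^d • x_{i+d}` and `p^d • x` is saturated with `x`.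
[cite: Howard2004HeegnerKolyvagin, Def. 1.1.2–1.1.3 and H.3 (arXiv p. 5 L88–99, p. 7 L65–67)] -/
theorem levelCondition_le_comap (p : ℕ) (C : ∀ j, AddSubgroup (H j)) (i d : ℕ) (mul : H i →+ H (i + d))
    (hM : ∀ y : H (i + d), mul (redIter red i d y) = p ^ d • y) :
    levelCondition red p C i ≤ (levelCondition red p C (i + d)).comap mul := by
  intro y hy
  rw [AddSubgroup.mem_comap, mem_levelCondition_iff]
  obtain ⟨x, hx, rfl⟩ := (mem_levelCondition_iff red p C i y).mp hy
  refine ⟨p ^ d • x, nsmul_mem_saturatedFamilies red p C hx _, ?_⟩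
  rw [Pi.smul_apply, ← hM,
    redIter_apply_of_mem_compatibleFamilies red (saturatedFamilies_le_compatibleFamilies red p C hx) i d]

/-- **Saturated level conditions are CARTESIAN** (the abstract core of Howard's H.3 for a Selmer structure
propagated from `V`): along a level map `mul : H_i → H_{i+d}` with (M) `mul ∘ red^{(d)} = p^d`, on a tower
with (T) `p^i • H_i = 0`, (L) liftability of the classes `y` whose image `mul y` lifts, and (E) `p^{i+d}`-
divisibility of the compatible families vanishing at level `i + d`, the preimage of the level-`(i+d)`
condition is EXACTLY the level-`i` condition: `mul⁻¹(L_{i+d}) = L_i`.  Proof of `⊆` (D1's memo, verbatim):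
`mul y = x_{i+d}` (`x` saturated); lift `y = z_i` (L); `(p^d z - x)_{i+d} = 0` by (M), so `p^d z - x = p^{i+d} h`
(E); `z' := z - p^i h` has `z'_i = y` (T) and `p^d z' = x`, hence is saturated; so `y ∈ L_i`.
[cite: Howard2004HeegnerKolyvagin, H.3 and Prop. 2.1.3 proof (arXiv p. 7 L65–67, p. 16 L1–3)]
[cite: MazurRubinMemoirs2004, Lemma 3.7.1] -/
theorem comap_levelCondition_eq_of_liftable (p : ℕ) (C : ∀ j, AddSubgroup (H j)) (i d : ℕ)
    (mul : H i →+ H (i + d))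
    (hM : ∀ y : H (i + d), mul (redIter red i d y) = p ^ d • y)
    (hT : ∀ y : H i, p ^ i • y = 0)
    (hL : ∀ y : H i, (∃ x ∈ compatibleFamilies red, mul y = x (i + d)) →
      ∃ z ∈ compatibleFamilies red, z i = y)
    (hE : ∀ x ∈ compatibleFamilies red, x (i + d) = 0 →
      ∃ h ∈ compatibleFamilies red, x = p ^ (i + d) • h) :
    (levelCondition red p C (i + d)).comap mul = levelCondition red p C i := by
  refine le_antisymm ?_ (levelCondition_le_comap red p C i d mul hM)
  intro y hy
  rw [AddSubgroup.mem_comap, mem_levelCondition_iff] at hy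
  obtain ⟨x, hx, hxy⟩ := hy
  have hxc : x ∈ compatibleFamilies red := saturatedFamilies_le_compatibleFamilies red p C hx
  -- (L): lift `y` to a compatible family `z`
  obtain ⟨z, hz, rfl⟩ := hL y ⟨x, hxc, hxy.symm⟩
  -- (M): `mul (z i) = p^d • z (i+d)`, so `p^d • z - x` vanishes at level `i + d`
  have hmul : mul (z i) = p ^ d • z (i + d) := by
    rw [← redIter_apply_of_mem_compatibleFamilies red hz i d, hM]
  have hvan : (p ^ d • z - x) (i + d) = 0 := by
    rw [Pi.sub_apply, Pi.smul_apply, ← hmul, hxy, sub_self]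
  -- (E): `p^d • z - x = p^(i+d) • h`
  obtain ⟨h, hh, hzx⟩ :=
    hE (p ^ d • z - x) (sub_mem (nsmul_mem_compatibleFamilies red hz _) hxc) hvan
  -- `z' := z - p^i • h` is saturated, with `z'_i = z_i`
  obtain ⟨a, ha⟩ := ((mem_saturatedFamilies_iff red p C x).mp hx).2
  have hz' : z - p ^ i • h ∈ saturatedFamilies red p C := by
    refine (mem_saturatedFamilies_iff red p C _).mpr ⟨?_, a + d, fun j => ?_⟩
    · exact (mem_compatibleFamilies_iff red _).mp
        (sub_mem hz (nsmul_mem_compatibleFamilies red hh _))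
    · -- `p^(a+d) • (z - p^i • h)_j = p^a • x_j ∈ C_j`
      have hj : p ^ d • (z - p ^ i • h) j = x j := by
        have hzxj := congrFun hzx j
        rw [Pi.sub_apply, Pi.smul_apply, Pi.smul_apply] at hzxj
        rw [Pi.sub_apply, Pi.smul_apply, smul_sub, ← mul_smul, ← pow_add, add_comm d i, ← hzxj,
          sub_sub_cancel]
      rw [pow_add, mul_smul, hj]
      exact ha j
  have hzi : (z - p ^ i • h) i = z i := by
    rw [Pi.sub_apply, Pi.smul_apply, hT, sub_zero]
  rw [← hzi]
  exact apply_mem_levelCondition red p C hz' i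

end Tower

end Literature.NumberTheory.EllipticCurves

end
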